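import Summits.BirchSwinnertonDyer.BirchSwinnertonDyer.Theorems.PrintCf2RubinValueTwoKatzMeasureJZeroClassOneOfPerLevel
import Summits.BirchSwinnertonDyer.BirchSwinnertonDyer.Theorems.PrintCf2RubinValueTwoKatzMeasureJZeroSeamP1OfLane
import Summits.BirchSwinnertonDyer.BirchSwinnertonDyer.Theorems.PrintCf2RubinValueTwoKatzMeasureJZeroSeamValuesOfLane
import HarnessLib

set_option linter.dupNamespace false
set_option autoImplicit false

/-!
# Route-C leaf `KatzDistributionsAtTwoJZeroClassOne` (stmt-BirchSwinnertonDyer-30221) MODULO ITS PRINTS, BY NAME — the `j = 0`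
# two-variable Katz–de Shalit distributions at `p = 2` for imaginary quadratic fields of class number one, from the lane

Cell `bsd-print-cf2`, width seat `bsd-line-cf2c-w4` g17 (LEAD g20 «α», 14:23Z); `--supports stmt-BirchSwinnertonDyer-30221` (helper).
THEOREMS ONLY; no `def`, no named fact, no `sorry`.

WHAT.  ★★★ `katzDistributionsAtTwoJZeroClassOne_of_lane (h15 h24i h24ii h24iii h25 h27) : KatzDistributionsAtTwoJZeroClassOne` — the WHOLE
measure lane of crux 20368 / print leaf 24720 (director OPTION 1, `j = 0` twin) composed BY NAME:
`katzDistributionsAtTwoJZeroClassOne_of_perLevel` (the last link, this seat) ∘ `KatzMeasureJZeroTop.P1_of_perUnitValues` (the bridge, width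
`-w3` g32, p774994) ∘ `KatzMeasureJZeroSeam.perUnitValues_of_lane` ([I2] v2 = FILE-4, LEAD g20, over FILE-1/3a/3b of width `-w8` g14, the
reference block of `-w7` g17, the integrality oracles and the `A₀`-unit socket of this seat, and the CM-bridge / division-point / Tate-unit
lineage of widths `cf2c-w4`, `-w2`, `-w5`, `-w7`).  CONDITIONAL ON SIX PRINTS, taken as hypotheses (named facts, nothing asserted):
II.1.5 `prop15_grossencharacterReciprocity`, II.2.4 (i) `prop24_i_mem_rayClassField`, (ii) `prop24_ii_galoisAction`, (iii) `prop24_iii_unit`,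
II.2.5 (i) `prop25_i_normRelation`, II.2.7 `prop27_power` — the conjunction the planner's rev-34 PRINTS SPLIT of 30221 files as the print leaf;
the OfPrints twin `KatzDistributionsAtTwoJZeroClassOneOfPrints` (route C rev 34, planner g24) is CLOSED BY NAME here:
★★★ `katzDistributionsAtTwoJZeroClassOneOfPrints_proof : Theses.PrintCf2RubinValueTwo.KatzDistributionsAtTwoJZeroClassOneOfPrints :=
fun hP ↦ katzDistributionsAtTwoJZeroClassOne_of_lane hP.1 hP.2.1 hP.2.2.1 hP.2.2.2.1 hP.2.2.2.2.1 hP.2.2.2.2.2`.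

HONEST FRAMING: a by-name composition of accepted theorems; 30221 is proved MODULO THE SIX PRINTS only (its OfPrints twin is the item closed);
the print leaf `PrintsKatzJZeroClassOneTwo` stays a declared print input; 24720 (all `j`) and 20368 are NOT closed; no summit statement is proved;
BSD is not proved by any of this.

References: [deShalit1987] E. de Shalit, *Iwasawa theory of elliptic curves with complex multiplication* (1987), II.1.5, II.2.4–2.7, II.4.9,
II.4.12 (31) (p. 66–67), II.4.14 (36)–(40) (p. 71–73), II.4.16 (49)–(50) (p. 76–77), II.4.17 (54) (p. 78).
-/

noncomputable section

open Literature.NumberTheory.ComplexMultiplication.EllipticUnits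

namespace Summit.BirchSwinnertonDyer.BirchSwinnertonDyer.Theorems.PrintCf2.KatzMeasureJZeroTop

/-- ★★★ **Route-C leaf 30221 `KatzDistributionsAtTwoJZeroClassOne` modulo its six prints, by name**: for every imaginary quadratic `K` of class
number one, `ι : ℚ̄₂ ≃ ℂ`, `2 = v·v̄` with `ι ↔ v`, there are de Shalit periods `(Ω, δ, Ω₂)` such that for every `S ∌ v, v̄`, every algebraic
Hecke character `λ` unramified outside `S ∪ {v, v̄}` and every independent pair of `ℤ₂`-extensions a bounded distribution (bound `≤ 1`) on `ℤ₂²`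
has de Shalit's interpolation property on the line `j = 0`, `3 ≤ m` — GIVEN de Shalit II.1.5 (the main theorem of complex multiplication in
lattice form), II.2.4 (i)(ii)(iii), II.2.5 (i) and II.2.7 as hypotheses. [cite: deShalit1987, II.4.12 (31), II.4.14 (36)–(40), II.4.16 (49)–(50), II.4.17 (54)] -/
theorem katzDistributionsAtTwoJZeroClassOne_of_lane
    (h15 : DeShalit1987.prop15_grossencharacterReciprocity)
    (h24i : DeShalit1987.prop24_i_mem_rayClassField) (h24ii : DeShalit1987.prop24_ii_galoisAction)
    (h24iii : DeShalit1987.prop24_iii_unit) (h25 : DeShalit1987.prop25_i_normRelation) (h27 : DeShalit1987.prop27_power) :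
    Summit.BirchSwinnertonDyer.BirchSwinnertonDyer.Theses.PrintCf2RubinValueTwo.KatzDistributionsAtTwoJZeroClassOne :=
  katzDistributionsAtTwoJZeroClassOne_of_perLevel h24i h24ii h24iii h25 h27
    (P1_of_perUnitValues h24ii h24iii h25 (KatzMeasureJZeroSeam.perUnitValues_of_lane h15 h24ii h24iii h25))

/-- ★★★ **The OfPrints twin of 30221, CLOSED BY NAME**: the six de Shalit prints (II.1.5, II.2.4 (i)(ii)(iii), II.2.5 (i), II.2.7 — the
print leaf `PrintsKatzJZeroClassOneTwo` of route C rev 34) imply `KatzDistributionsAtTwoJZeroClassOne`; one application of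
`katzDistributionsAtTwoJZeroClassOne_of_lane`. [cite: deShalit1987, II.4.12 (31), II.4.14 (36)–(40), II.4.16 (49)–(50), II.4.17 (54)] -/
theorem katzDistributionsAtTwoJZeroClassOneOfPrints_proof :
    Summit.BirchSwinnertonDyer.BirchSwinnertonDyer.Theses.PrintCf2RubinValueTwo.KatzDistributionsAtTwoJZeroClassOneOfPrints :=
  fun hP ↦ katzDistributionsAtTwoJZeroClassOne_of_lane hP.1 hP.2.1 hP.2.2.1 hP.2.2.2.1 hP.2.2.2.2.1 hP.2.2.2.2.2

end Summit.BirchSwinnertonDyer.BirchSwinnertonDyer.Theorems.PrintCf2.KatzMeasureJZeroTop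

end
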